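import Mathlib.LinearAlgebra.BilinearForm.Properties
import Mathlib.LinearAlgebra.Span.Basic
import Mathlib.RingTheory.Finiteness.Basic
import Mathlib.RingTheory.Noetherian.Basic
import Mathlib.RingTheory.PrincipalIdealDomain
import Literature.AlgebraicGeometry.HodgeTheory.LocallyTrivialExtensionClasses
import Summits.HodgeConjecture.HodgeConjecture.Theorems.LinearSystemTorelliLocalTubeSpanTransvections

/-!
# Route LinearSystemTorelli — crux `LocalTubeSpan`: the orbit-saturation of finite integral data

Helper file (`--supports stmt-HodgeConjecture-2490`, line `Sketch`, stub `stub_saturation`).  The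
case theorems of the algebraic spine of the crux ("local Schnell theorem": injectivity of Schnell's
third map `H¹(G, V) → ∏_g V/(g - 1)V` for a local monodromy group acting on the vanishing cohomology
`V = H^{2p-1}(X_s, ℚ)_van`, alternating intersection form `B`, through Picard–Lefschetz
transvections `T_δ(x) = x - B(x, δ) δ`) — `localTubeSpan_injective_evalCoinv_of_completeOrbit`
(`…Radical.lean`) and `localTubeSpan_injective_evalCoinv_of_orthogonalClusters` (`…Clusters.lean`) —
consume ORBIT DATA about the (infinite) set `Δ` of all local vanishing cycles: every `T_δ`,
`δ ∈ Δ`, realised in the group, `ℤΔ` finitely generated, `B` integral on `Δ × Δ`, `Δ` stable and a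
single orbit.  Geometrically one is handed FINITE data: the cycles `e(t)` of finitely many local
meridians `t ∈ s₁`, acting as `T_{e(t)}`, with integral pairings `B(e t, e t') ∈ ℤ`, lying in one
`⟨s₁⟩`-orbit.  This file shows that the orbit-saturation

  `Δ = ⟨s₁⟩ · e(s₁) = {g · e(t) | g ∈ ⟨s₁⟩, t ∈ s₁}`

carries everything the consumers need (`localTubeSpan_saturation`, seven conclusions):
(1) `e(t) ∈ Δ`; (2) `Δ ⊆ ℚ e(s₁)`; (3) every `T_δ`, `δ ∈ Δ`, is the action of an element of `⟨s₁⟩`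
(the conjugate meridian `g t g⁻¹`); (4) `ℤΔ` is finitely generated (it lies in the lattice
`Λ = ℤ e(s₁)`, which is `⟨s₁⟩`-stable because the pairings are integral, and `ℤ` is Noetherian);
(5) `B(Δ, Δ) ⊆ ℤ`; (6) `Δ` is `⟨s₁⟩`-stable; (7) `Δ` is a single `⟨s₁⟩`-orbit.  The ingredients
(isometry of the group, the inverse transvection `T_δ⁻¹(x) = x + B(x, δ)δ`, integrality on the
`ℤ`-span, stability of `Λ`) are recorded as separate `localTubeSpan_…` lemmas for a monoid hom
`ρ : G →* End V`.

References: C. Schnell, *Primitive cohomology and the tube mapping*, Math. Z. 268 (2010) §7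
(skew-symmetric vanishing lattices `(V_ℤ, Δ)` of a Lefschetz pencil: `Δ` = all vanishing cycles, the
orbit of any one of them); W. Janssen, *Skew-symmetric vanishing lattices and their monodromy
groups*, Math. Ann. 266 (1983).  Elementary; no named facts.
-/

-- `Summit.HodgeConjecture.HodgeConjecture.Theorems` is the mandated namespace (single-conjunct summit:
-- Sub = Summit), which `linter.dupNamespace` flags on every declaration; the lakefile turns the
-- linter off tree-wide (weak option), restated here so stand-alone elaboration is warning-free too.
set_option linter.dupNamespace false

noncomputable section

open CategoryTheory groupCohomology
open Literature.AlgebraicGeometry.HodgeTheory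

namespace Summit.HodgeConjecture.HodgeConjecture.Theorems

/-! ### Transvection groups generated by finitely many meridians -/

section Generators

variable {G : Type*} [Group G] {V : Type*} [AddCommGroup V] [Module ℚ V]
  (ρ : G →* (V →ₗ[ℚ] V)) (B : LinearMap.BilinForm ℚ V)

/-- The inverse of a Picard–Lefschetz transvection `T_δ(x) = x - B(x, δ)δ` of an alternating form is
`T_δ⁻¹(x) = x + B(x, δ)δ`. [folklore] -/
theorem localTubeSpan_inv_transvection_formula (hB : B.IsAlt) (t : G) (δ : V)
    (ht : ∀ x, ρ t x = x - B x δ • δ) (x : V) : ρ t⁻¹ x = x + B x δ • δ := by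
  have h1 : ρ t (x + B x δ • δ) = x := by
    rw [ht]
    simp only [map_add, map_smul, LinearMap.add_apply, LinearMap.smul_apply, smul_eq_mul,
      hB.self_eq_zero, mul_zero, add_zero, add_sub_cancel_right]
  calc ρ t⁻¹ x = ρ t⁻¹ (ρ t (x + B x δ • δ)) := by rw [h1]
    _ = x + B x δ • δ := by
        rw [← Module.End.mul_apply, ← map_mul, inv_mul_cancel, map_one, Module.End.one_apply]

/-- A group generated by elements acting as transvections of an alternating form acts (through its
generated subgroup) by isometries. [folklore] -/
theorem localTubeSpan_isometry_of_mem_closure (hB : B.IsAlt) (s₁ : Set G) (e : G → V)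
    (hPL : ∀ t ∈ s₁, ∀ x, ρ t x = x - B x (e t) • e t) {g : G} (hg : g ∈ Subgroup.closure s₁)
    (x y : V) : B (ρ g x) (ρ g y) = B x y := by
  induction hg using Subgroup.closure_induction generalizing x y with
  | mem t ht =>
      exact localTubeSpan_isometry_of_transvection_formula B hB (e t) (ρ t) (hPL t ht) x y
  | one => simp
  | mul g h _ _ ihg ihh => rw [map_mul, Module.End.mul_apply, Module.End.mul_apply, ihg, ihh]
  | inv g _ ih =>
      have := ih (ρ g⁻¹ x) (ρ g⁻¹ y)
      rw [← Module.End.mul_apply, ← Module.End.mul_apply, ← map_mul, mul_inv_cancel, map_one,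
        Module.End.one_apply, Module.End.one_apply] at this
      exact this.symm

/-- **Conjugate meridians act as transvections along the transported cycles** (closure version):
if the generators `t ∈ s₁` act as `T_{e(t)}`, then for `g ∈ ⟨s₁⟩` the conjugate `g t g⁻¹ ∈ ⟨s₁⟩`
acts as `T_{g · e(t)}`. [cite: Schnell2010, §7 (Skew-symmetric vanishing lattices)] -/
theorem localTubeSpan_conj_mem_closure_formula (hB : B.IsAlt) (s₁ : Set G) (e : G → V)
    (hPL : ∀ t ∈ s₁, ∀ x, ρ t x = x - B x (e t) • e t) {g : G} (hg : g ∈ Subgroup.closure s₁)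
    {t : G} (ht : t ∈ s₁) (x : V) :
    ρ (g * t * g⁻¹) x = x - B x (ρ g (e t)) • ρ g (e t) := by
  have e1 : B (ρ g⁻¹ x) (e t) = B x (ρ g (e t)) := by
    rw [← localTubeSpan_isometry_of_mem_closure ρ B hB s₁ e hPL hg (ρ g⁻¹ x) (e t),
      ← Module.End.mul_apply, ← map_mul, mul_inv_cancel, map_one, Module.End.one_apply]
  rw [map_mul, map_mul, Module.End.mul_apply, Module.End.mul_apply, hPL t ht, map_sub, map_smul,
    e1, ← Module.End.mul_apply, ← map_mul, mul_inv_cancel, map_one, Module.End.one_apply]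

/-- Integrality of `B(·, z)` propagates from a set to its `ℤ`-span. [folklore] -/
theorem localTubeSpan_exists_int_eq_of_mem_span_int (S : Set V) (z : V)
    (hS : ∀ y ∈ S, ∃ n : ℤ, B y z = n) {y : V} (hy : y ∈ Submodule.span ℤ S) :
    ∃ n : ℤ, B y z = n := by
  induction hy using Submodule.span_induction with
  | mem y hy => exact hS y hy
  | zero => exact ⟨0, by rw [map_zero, LinearMap.zero_apply, Int.cast_zero]⟩
  | add y y' _ _ hy hy' =>
      obtain ⟨n, hn⟩ := hy
      obtain ⟨n', hn'⟩ := hy'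
      exact ⟨n + n', by rw [map_add, LinearMap.add_apply, hn, hn', Int.cast_add]⟩
  | smul n y _ hy =>
      obtain ⟨m, hm⟩ := hy
      refine ⟨n * m, ?_⟩
      rw [← Int.cast_smul_eq_zsmul ℚ n y, map_smul, LinearMap.smul_apply, hm, smul_eq_mul,
        Int.cast_mul]

omit [Group G] in
/-- If the generator cycles pair integrally, `B` is integral on the lattice `Λ = ℤ e(s₁)`.
[folklore] -/
theorem localTubeSpan_exists_int_eq_of_mem_span_int₂ (s₁ : Set G) (e : G → V)
    (hint : ∀ t ∈ s₁, ∀ t' ∈ s₁, ∃ n : ℤ, B (e t) (e t') = n)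
    {y : V} (hy : y ∈ Submodule.span ℤ (e '' s₁)) {z : V} (hz : z ∈ Submodule.span ℤ (e '' s₁)) :
    ∃ n : ℤ, B y z = n := by
  refine localTubeSpan_exists_int_eq_of_mem_span_int B (e '' s₁) z ?_ hy
  rintro _ ⟨t, ht, rfl⟩
  obtain ⟨n, hn⟩ := localTubeSpan_exists_int_eq_of_mem_span_int B.flip (e '' s₁) (e t)
    (by
      rintro _ ⟨t', ht', rfl⟩
      obtain ⟨n, hn⟩ := hint t ht t' ht'
      exact ⟨n, by rw [LinearMap.BilinForm.flip_apply, hn]⟩) hz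
  exact ⟨n, by rw [← hn, LinearMap.BilinForm.flip_apply]⟩

/-- **The lattice `Λ = ℤ e(s₁)` is `⟨s₁⟩`-stable** when the generators act as transvections
`T_{e(t)}` of an alternating form with integral pairings `B(e t, e t') ∈ ℤ`:
`T_{e(t)}^{±1}(y) = y ∓ B(y, e t) e(t)` with `B(y, e t) ∈ ℤ` for `y ∈ Λ`. [folklore] -/
theorem localTubeSpan_span_int_stable_of_mem_closure (hB : B.IsAlt) (s₁ : Set G) (e : G → V)
    (hPL : ∀ t ∈ s₁, ∀ x, ρ t x = x - B x (e t) • e t)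
    (hint : ∀ t ∈ s₁, ∀ t' ∈ s₁, ∃ n : ℤ, B (e t) (e t') = n)
    {g : G} (hg : g ∈ Subgroup.closure s₁) {y : V} (hy : y ∈ Submodule.span ℤ (e '' s₁)) :
    ρ g y ∈ Submodule.span ℤ (e '' s₁) := by
  induction hg using Subgroup.closure_induction'' generalizing y with
  | mem t ht =>
      obtain ⟨n, hn⟩ := localTubeSpan_exists_int_eq_of_mem_span_int₂ B s₁ e hint hy
        (Submodule.subset_span ⟨t, ht, rfl⟩)
      rw [hPL t ht, hn, Int.cast_smul_eq_zsmul]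
      exact Submodule.sub_mem _ hy (Submodule.smul_mem _ n (Submodule.subset_span ⟨t, ht, rfl⟩))
  | inv_mem t ht =>
      obtain ⟨n, hn⟩ := localTubeSpan_exists_int_eq_of_mem_span_int₂ B s₁ e hint hy
        (Submodule.subset_span ⟨t, ht, rfl⟩)
      rw [localTubeSpan_inv_transvection_formula ρ B hB t (e t) (hPL t ht), hn,
        Int.cast_smul_eq_zsmul]
      exact Submodule.add_mem _ hy (Submodule.smul_mem _ n (Submodule.subset_span ⟨t, ht, rfl⟩))
  | one => rwa [map_one, Module.End.one_apply]
  | mul g h _ _ ihg ihh => rw [map_mul, Module.End.mul_apply]; exact ihg (ihh hy)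

/-- Every transported generator cycle `g · e(t)` (`g ∈ ⟨s₁⟩`, `t ∈ s₁`) lies in the lattice
`Λ = ℤ e(s₁)`. [folklore] -/
theorem localTubeSpan_orbit_mem_span_int (hB : B.IsAlt) (s₁ : Set G) (e : G → V)
    (hPL : ∀ t ∈ s₁, ∀ x, ρ t x = x - B x (e t) • e t)
    (hint : ∀ t ∈ s₁, ∀ t' ∈ s₁, ∃ n : ℤ, B (e t) (e t') = n)
    {g : G} (hg : g ∈ Subgroup.closure s₁) {t : G} (ht : t ∈ s₁) :
    ρ g (e t) ∈ Submodule.span ℤ (e '' s₁) :=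
  localTubeSpan_span_int_stable_of_mem_closure ρ B hB s₁ e hPL hint hg
    (Submodule.subset_span ⟨t, ht, rfl⟩)

/-- The pairings of transported generator cycles are integral:
`B(g · e(t), g' · e(t')) ∈ ℤ`. [cite: Schnell2010, §7 (Skew-symmetric vanishing lattices)] -/
theorem localTubeSpan_orbit_integral (hB : B.IsAlt) (s₁ : Set G) (e : G → V)
    (hPL : ∀ t ∈ s₁, ∀ x, ρ t x = x - B x (e t) • e t)
    (hint : ∀ t ∈ s₁, ∀ t' ∈ s₁, ∃ n : ℤ, B (e t) (e t') = n)
    {g : G} (hg : g ∈ Subgroup.closure s₁) {t : G} (ht : t ∈ s₁)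
    {g' : G} (hg' : g' ∈ Subgroup.closure s₁) {t' : G} (ht' : t' ∈ s₁) :
    ∃ n : ℤ, B (ρ g (e t)) (ρ g' (e t')) = n :=
  localTubeSpan_exists_int_eq_of_mem_span_int₂ B s₁ e hint
    (localTubeSpan_orbit_mem_span_int ρ B hB s₁ e hPL hint hg ht)
    (localTubeSpan_orbit_mem_span_int ρ B hB s₁ e hPL hint hg' ht')

/-- The `ℤ`-span of the orbit-saturation `⟨s₁⟩ · e(s₁)` of finitely many generator cycles with
integral pairings is finitely generated (a sublattice of `ℤ e(s₁)`; `ℤ` is Noetherian).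
[cite: Schnell2010, §7 (Skew-symmetric vanishing lattices)] -/
theorem localTubeSpan_fg_span_int_orbit (hB : B.IsAlt) (s₁ : Set G) (hs₁ : s₁.Finite) (e : G → V)
    (hPL : ∀ t ∈ s₁, ∀ x, ρ t x = x - B x (e t) • e t)
    (hint : ∀ t ∈ s₁, ∀ t' ∈ s₁, ∃ n : ℤ, B (e t) (e t') = n) :
    (Submodule.span ℤ {x : V | ∃ g ∈ Subgroup.closure s₁, ∃ t ∈ s₁, ρ g (e t) = x}).FG := by
  refine (Submodule.fg_span (hs₁.image e)).of_le (Submodule.span_le.2 ?_)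
  rintro _ ⟨g, hg, t, ht, rfl⟩
  exact localTubeSpan_orbit_mem_span_int ρ B hB s₁ e hPL hint hg ht

/-- The transvection along a transported generator cycle `g · e(t)` is realised by the conjugate
meridian `g t g⁻¹ ∈ ⟨s₁⟩`. [cite: Schnell2010, §7 (Skew-symmetric vanishing lattices)] -/
theorem localTubeSpan_orbit_realised (hB : B.IsAlt) (s₁ : Set G) (e : G → V)
    (hPL : ∀ t ∈ s₁, ∀ x, ρ t x = x - B x (e t) • e t) {g : G} (hg : g ∈ Subgroup.closure s₁)
    {t : G} (ht : t ∈ s₁) :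
    ∃ g' ∈ Subgroup.closure s₁, ∀ x : V, ρ g' x = x - B x (ρ g (e t)) • ρ g (e t) :=
  ⟨g * t * g⁻¹, Subgroup.mul_mem _ (Subgroup.mul_mem _ hg (Subgroup.subset_closure ht))
    (Subgroup.inv_mem _ hg), localTubeSpan_conj_mem_closure_formula ρ B hB s₁ e hPL hg ht⟩

/-- The orbit-saturation is `⟨s₁⟩`-stable: `h · (g · e(t)) = (h g) · e(t)`. [folklore] -/
theorem localTubeSpan_orbit_stable (s₁ : Set G) (e : G → V) {h : G} (hh : h ∈ Subgroup.closure s₁)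
    {g : G} (hg : g ∈ Subgroup.closure s₁) {t : G} (ht : t ∈ s₁) :
    ∃ g' ∈ Subgroup.closure s₁, ∃ t' ∈ s₁, ρ g' (e t') = ρ h (ρ g (e t)) :=
  ⟨h * g, Subgroup.mul_mem _ hh hg, t, ht, by rw [map_mul, Module.End.mul_apply]⟩

/-- If the generator cycles lie in one `⟨s₁⟩`-orbit, so does the whole orbit-saturation:
`(g' k g⁻¹) · (g · e(t)) = g' · e(t')` when `k · e(t) = e(t')`. [folklore] -/
theorem localTubeSpan_orbit_transitive (s₁ : Set G) (e : G → V)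
    (horb : ∀ t ∈ s₁, ∀ t' ∈ s₁, ∃ g ∈ Subgroup.closure s₁, ρ g (e t) = e t')
    {g : G} (hg : g ∈ Subgroup.closure s₁) {t : G} (ht : t ∈ s₁)
    {g' : G} (hg' : g' ∈ Subgroup.closure s₁) {t' : G} (ht' : t' ∈ s₁) :
    ∃ k ∈ Subgroup.closure s₁, ρ k (ρ g (e t)) = ρ g' (e t') := by
  obtain ⟨k, hk, hke⟩ := horb t ht t' ht'
  refine ⟨g' * k * g⁻¹, Subgroup.mul_mem _ (Subgroup.mul_mem _ hg' hk) (Subgroup.inv_mem _ hg), ?_⟩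
  rw [← Module.End.mul_apply, ← map_mul, inv_mul_cancel_right, map_mul, Module.End.mul_apply, hke]

end Generators

/-! ### The orbit-saturation of finite integral data -/

section Saturation

variable {G : Type} [Group G] (A : Rep.{0} ℚ G)

/-- **Orbit-saturation of finite integral data** (stub `stub_saturation` of line `Sketch`).  Let the
finitely many generators `t ∈ s₁` act on `V = A` as Picard–Lefschetz transvections
`x ↦ x - B(x, e t) e(t)` of an alternating form `B`, with integral pairings `B(e t, e t') ∈ ℤ` and
all `e(t)` in one `⟨s₁⟩`-orbit.  Then the orbit-saturation `Δ = ⟨s₁⟩ · e(s₁)` contains the `e(t)`,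
lies in `ℚ e(s₁)`, has every `T_δ` (`δ ∈ Δ`) realised in `⟨s₁⟩`, has `ℤΔ` finitely generated and
`B(Δ, Δ) ⊆ ℤ`, and is a single `⟨s₁⟩`-stable `⟨s₁⟩`-orbit — the orbit data consumed by
`localTubeSpan_injective_evalCoinv_of_completeOrbit` / `…_of_orthogonalClusters`.
[cite: Schnell2010, §7 (Skew-symmetric vanishing lattices)] -/
theorem localTubeSpan_saturation (B : LinearMap.BilinForm ℚ A.V) (hB : B.IsAlt) (s₁ : Set G)
    (hs₁ : s₁.Finite) (e : G → A.V) (hPL : ∀ t ∈ s₁, ∀ x : A.V, A.ρ t x = x - B x (e t) • e t)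
    (hint : ∀ t ∈ s₁, ∀ t' ∈ s₁, ∃ n : ℤ, B (e t) (e t') = n)
    (horb : ∀ t ∈ s₁, ∀ t' ∈ s₁, ∃ g ∈ Subgroup.closure s₁, A.ρ g (e t) = e t')
    (Δ : Set A.V) (hΔ : Δ = {x : A.V | ∃ g ∈ Subgroup.closure s₁, ∃ t ∈ s₁, A.ρ g (e t) = x}) :
    (∀ t ∈ s₁, e t ∈ Δ) ∧
    (∀ δ ∈ Δ, δ ∈ Submodule.span ℚ (e '' s₁)) ∧
    (∀ δ ∈ Δ, ∃ g ∈ Subgroup.closure s₁, ∀ x : A.V, A.ρ g x = x - B x δ • δ) ∧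
    (Submodule.span ℤ Δ).FG ∧
    (∀ δ ∈ Δ, ∀ δ' ∈ Δ, ∃ n : ℤ, B δ δ' = n) ∧
    (∀ g ∈ Subgroup.closure s₁, ∀ δ ∈ Δ, A.ρ g δ ∈ Δ) ∧
    (∀ δ ∈ Δ, ∀ δ' ∈ Δ, ∃ g ∈ Subgroup.closure s₁, A.ρ g δ = δ') := by
  subst hΔ
  refine ⟨fun t ht => ⟨1, Subgroup.one_mem _, t, ht, by rw [map_one, Module.End.one_apply]⟩,
    ?_, ?_, localTubeSpan_fg_span_int_orbit A.ρ B hB s₁ hs₁ e hPL hint, ?_, ?_, ?_⟩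
  · rintro _ ⟨g, hg, t, ht, rfl⟩
    exact Submodule.span_le_restrictScalars ℤ ℚ (e '' s₁)
      (localTubeSpan_orbit_mem_span_int A.ρ B hB s₁ e hPL hint hg ht)
  · rintro _ ⟨g, hg, t, ht, rfl⟩
    exact localTubeSpan_orbit_realised A.ρ B hB s₁ e hPL hg ht
  · rintro _ ⟨g, hg, t, ht, rfl⟩ _ ⟨g', hg', t', ht', rfl⟩
    exact localTubeSpan_orbit_integral A.ρ B hB s₁ e hPL hint hg ht hg' ht'
  · rintro h hh _ ⟨g, hg, t, ht, rfl⟩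
    exact localTubeSpan_orbit_stable A.ρ s₁ e hh hg ht
  · rintro _ ⟨g, hg, t, ht, rfl⟩ _ ⟨g', hg', t', ht', rfl⟩
    exact localTubeSpan_orbit_transitive A.ρ s₁ e horb hg ht hg' ht'

end Saturation

end Summit.HodgeConjecture.HodgeConjecture.Theorems

end
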